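import Mathlib
import Literature.AlgebraicGeometry.Resolution.Lipman1969RationalSurfaceSingularities
import HarnessLib

/-!
# Route `HomologicalConductor`, support `SurfaceTermination` (stmt-ResolutionOfSingularities-16488):
# the geometric genus bound `p_g ≤ g` — vocabulary of the LINE genus-descent

`[OURS · L W4.4]` Cell res-hironaka, crux chain W4.4, kill test K4.4-s.  The Prop below is the TEXT of
res-L0-w44-strat-1's LINE genus-descent rev 2 (`L/res-L0-w44-strat-1/line-genus-descent.lean` sha16
9bfce1c0a38f021d, l.87; signatures of stubs 1–5 frozen 09:33Z), copied VERBATIM so that the line's stubs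
`stub_pgFinite` / `stub_pgNonincreasing` / `stub_constantGenusPrimeDivisor` can be landed BY NAME under
`Theorems/` (only the namespace and the docstrings are edited).  Nothing here is a statement of the manuscript
under review (Hironaka 2017); AI-written, weaker than expert review.

* `HasGeometricGenusLE R g` — «`p_g(R) ≤ g`»: SOME desingularisation `f : X → Spec R` (`IsResolution`) has
  `length_R Ȟ¹(𝒰, 𝒪_X) ≤ g` for EVERY finite affine open cover `𝒰` of `X` (`CechH1`, the tree's Čech `H¹`
  of the structure sheaf; for `X` separated this is `H¹(X, 𝒪_X)`).  With `g = 0` it is literally the tree's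
  `HasRationalSingularity R` (Lipman 1969, Def. (1.1)): `hasGeometricGenusLE_zero_iff`, `hasRationalSingularity_of_genusLE_zero`;
  `hasGeometricGenusLE_mono` (monotone in `g`).  (CHAIN v13 §2 object U5.)

No other theorem.

References: J. Lipman, *Rational singularities…*, Publ. IHÉS 36 (1969), Def. (1.1) (p. 199) [`Lipman1969`].
-/

-- single-problem summit: the doubled namespace component `ResolutionOfSingularities` is forced
set_option linter.dupNamespace false

noncomputable section

open CategoryTheory AlgebraicGeometry
open Literature.AlgebraicGeometry.Resolution Literature.AlgebraicGeometry.Morphisms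

namespace Summit.ResolutionOfSingularities.ResolutionOfSingularities.Theorems.SurfaceTermination.GenusDescent

/-- **`p_g(R) ≤ g`**: some desingularisation `f : X → Spec R` (`IsResolution`: proper, birational, `X`
regular) has `length_R Ȟ¹(𝒰, 𝒪_X) ≤ g` for every finite affine open cover `𝒰` of `X` (for `X` separated,
`Ȟ¹(𝒰, 𝒪_X) = H¹(X, 𝒪_X)`).  With `g = 0` this is literally `HasRationalSingularity R` (Lipman 1969,
Def. (1.1)); for a two-dimensional normal excellent local domain `length_R H¹(X, 𝒪_X)` is the geometric genus
`p_g(R)`, independent of the desingularisation.  The text of res-L0-w44-strat-1's LINE genus-descent rev 2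
(l.87), verbatim.  OURS. [this work] -/
def HasGeometricGenusLE (R : Type) [CommRing R] (g : ℕ) : Prop :=
  ∃ (X : Scheme.{0}) (f : X ⟶ Spec (.of R)), IsResolution f ∧
    ∀ (ι : Type) [Finite ι] (U : ι → X.Opens), (∀ i, IsAffineOpen (U i)) → ⨆ i, U i = ⊤ →
      Module.length R (CechH1 f U) ≤ (g : ℕ∞)

/-- Unfolding of `HasGeometricGenusLE` (`Iff.rfl`). [folklore] -/
theorem hasGeometricGenusLE_iff (R : Type) [CommRing R] (g : ℕ) :
    HasGeometricGenusLE R g ↔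
      ∃ (X : Scheme.{0}) (f : X ⟶ Spec (.of R)), IsResolution f ∧
        ∀ (ι : Type) [Finite ι] (U : ι → X.Opens), (∀ i, IsAffineOpen (U i)) → ⨆ i, U i = ⊤ →
          Module.length R (CechH1 f U) ≤ (g : ℕ∞) :=
  Iff.rfl

/-- **Monotonicity in `g`.** [this work] -/
theorem hasGeometricGenusLE_mono {R : Type} [CommRing R] {g g' : ℕ} (h : g ≤ g') :
    HasGeometricGenusLE R g → HasGeometricGenusLE R g' := by
  rintro ⟨X, f, hf, hH⟩
  exact ⟨X, f, hf, fun ι _ U hU hcov => (hH ι U hU hcov).trans (by exact_mod_cast h)⟩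

/-- **Genus `≤ 0` IS Lipman's rationality** (the tree's `HasRationalSingularity`): a module has length
`≤ 0` iff it is trivial. [cite: Lipman1969, Definition (1.1) (p. 199)] -/
theorem hasGeometricGenusLE_zero_iff (R : Type) [CommRing R] :
    HasGeometricGenusLE R 0 ↔ HasRationalSingularity R := by
  constructor
  · rintro ⟨X, f, hf, hH⟩
    refine ⟨X, f, hf, fun ι _ U hU hcov => ?_⟩
    have h0 := hH ι U hU hcov
    rw [Nat.cast_zero, nonpos_iff_eq_zero, Module.length_eq_zero_iff] at h0
    exact h0
  · rintro ⟨X, f, hf, hH⟩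
    refine ⟨X, f, hf, fun ι _ U hU hcov => ?_⟩
    haveI := hH ι U hU hcov
    rw [Module.length_eq_zero, Nat.cast_zero]

/-- Genus `≤ 0` implies rationality (the line's `hasRationalSingularity_of_genusLE_zero`, same text).
[cite: Lipman1969, Definition (1.1) (p. 199)] -/
theorem hasRationalSingularity_of_genusLE_zero {R : Type} [CommRing R] (h : HasGeometricGenusLE R 0) :
    HasRationalSingularity R :=
  (hasGeometricGenusLE_zero_iff R).mp h

end Summit.ResolutionOfSingularities.ResolutionOfSingularities.Theorems.SurfaceTermination.GenusDescent

end
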